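import Summits.BirchSwinnertonDyer.Rank1Residual.X4.KuriharaLowerHalf
import Summits.BirchSwinnertonDyer.Rank1Residual.Supersingular.X6KuriharaOfferShape
import Summits.BirchSwinnertonDyer.Rank1Residual.Supersingular.CyclicityLadder
import Literature.NumberTheory.EllipticCurves.PerrinRiou2003.RankZeroSupersingularUpperBound
import HarnessLib

/-!
# N4 TAM-DEFECT (X6 ∧ `r_an = 0` ∧ `p ∣ ∏c_ℓ`, `p ≥ 5`): `BSD(E,p)` per pair from ONE Kurihara number of depth
# `k ≤ ord_p ∏c_ℓ + 1` (Kim 2026 Thm. 1.9 (6), PUBLISHED) and Perrin-Riou's rank-zero upper bound (Prop. 4.8, PUBLISHED) —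
# the shapes (class form and literal-equation record form)

Cell `b2b-bsdres`, supersingular family, prover A = unit `b2b-bsdres-x10b` (gen 13; X6 = A's class, N4 class lead).  Topic file;
namespace `Summit.BirchSwinnertonDyer.Rank1Residual.Supersingular`.  THEOREMS ONLY (compositions of tree theorems by name); no named
fact minted, no definition, nothing asserted about any curve, nothing booked; X6 stays CONSTRUCTION-SHAPED (RESIDUAL-MAP §I N4).

HONEST FRAMING (run/shared/lean/b2b/bsd-rank1-residual/, verbatim in every file): the goal of the
cell is to DELETE the COMBINATION-SHAPED residual classes of the Birch–Swinnerton-Dyer formula for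
ALL analytic-rank `≤ 1` elliptic curves over `ℚ` — "full BSD formula for every rank `≤ 1` curve in
class `C`" assembled STRICTLY from published theorems — so that the rank-`≤ 1` remainder becomes
exactly the CONSTRUCTION-SHAPED classes, which are TYPED (missing-input `Prop`s), NOT attempted.
This is not "finishing BSD".

## Why this file exists

The N4 per-pair instrument residue has been, since gen 10, EXACTLY the 5 TAM-DEFECT cells (22678e1@5, 130798a1@7, 145146q1@5,
399190l1@7, 492414f1@5: X6, `r_an = 0`, `ord_p ∏c_ℓ ≥ 1`, `ord_p #Ш_an = 2`), recorded as 'no executable route' because a UNIT Kurihara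
number cannot exist there (Kim's §1.5.3: `∂^{(∞)}(δ̃) ≥ ord_p ∏c_ℓ`).  But the tree meanwhile acquired (cc-typer / n1011 lineage, for N10)
the DEPTH-`k` reading of Kim's published structure theorem: `Kim2026.rankZero_le_padicValNat_sha_of_kuriharaNumber_ne_zero`
(Kim, AJM 148 (2026) Thm. 1.8 (6) = arXiv Thm. 1.9 (6): a Kurihara number `δ̃_n^{(k)} ≢ 0 (mod p^k)` at a cyclic `n ∈ 𝒩_k` gives
`ord_p(L(E,1)/Ω) ≤ ord_p #Ш[p^∞] + (k − 1)`, ANY reduction at `p`), packaged class-free as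
`X4.bsdp_rankZero_of_kimLower_of_missingUpperBoundAt` (`k ≤ ord_p ∏c_ℓ + 1` + any upper half ⇒ `BSD(E,p)`); and the typed
rank-zero supersingular upper half `PerrinRiou2003.missingUpperBoundAt_of_prop48_of_surj` (Prop. 4.8; x10b gen 11 re-based every N4
consumer on it).  On X6 at `p ≥ 5` surjectivity is automatic (`ClassX6.surj`).  And iw-2's ENGINE K v1.3 depth-2 run (ENGINE-K-P9.md
§N4TAM, kit j138076) VALUED `δ̃^{(2)}_{151·2551}(145146q1) ≡ 10 (mod 25)` — `ord₅ = 1 = ord₅ ∏c_ℓ`, exactly Kim's prediction — and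
handed the label to this seat.  So a per-pair route for the TAM-DEFECT cells DOES exist; this file is its kernel shape.

## What this file proves

* §1 `X6RankZero.bsdp_of_kimLower_of_prop48` — class form: `ClassX6 W p`, `p ≥ 5`, `r_an = 0`, a modular parametrisation datum `D`
  with `p ∤ c_D` and the period transfer `Ω(W) = u·Ω⁺_{D.f}` (`|u|_p = 1`), a cyclic level `n ∈ 𝒩_k` with `1 ≤ k ≤ ord_p ∏c_ℓ + 1`,
  surjective `ψ`, and `kuriharaNumber D.f (p^k) n ψ ≠ 0` ⟹ `BSDp W p`.  Named facts: `hKimL` (Kim 2026 Thm 1.9 (6), PUBLISHED),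
  `h48` (Perrin-Riou 2003 Prop. 4.8, PUBLISHED), `hGZK`, `hmod`.
* §2 `X6RankZero.bsdp_of_kimLower_of_prop48_of_ainvs` — the literal-equation RECORD SHAPE at a two-prime level `ℓ₁ℓ₂ ∈ 𝒩_k`:
  minimality as an instance hypothesis (x11c bounded Kraus per record), class X6 read off the model (`classX6_of_intModel`), the
  Kolyvagin primes from point counts (`ℓᵢ ≡ 1 (mod p^k)`, `p^k ∣ #Ẽ(𝔽_ℓᵢ)`), CYCLICITY as two per-prime hypotheses in the literal-model
  form that `CyclicityLadder.lean` (this gen) certifies — at depth `k ≥ 2` the count is always silent (`p^k ∣ #Ẽ(𝔽_ℓ)`), so the ladder is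
  the only kernel route —, `ψ` ANY family surjective at `ℓ₁, ℓ₂` (non-vanishing of `δ̃_n` modulo `p^k` is independent of the choice:
  `δ̃_n` is multilinear in the `ψ_ℓ`), and the data binders `r_an = 0`, `k ≤ ord_p ∏c_ℓ + 1` (Cremona), `hc`, `hper`, `hδ`.

The record built on §2 (`X6KimTamDefectRecords.lean`, this gen) is the N4 TAM-DEFECT cell 145146q1@5 with `hδ` = the depth-2 datum
(iw-2 ENGINE K; this seat's implementation 3d depth-2 run as the second engine).  Tier: EVIDENCE-grade per-pair theorem modulo PUBLISHED
named facts + data binders; nothing booked.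

References: C.-H. Kim, AJM 148 (2026) Thm. 1.8 (6), §1.2.2, §1.5.1–1.5.3 [Kim2022StructureSelmer]; B. Perrin-Riou, Exp. Math. 12
(2003) Prop. 4.8 [PerrinRiou2003]; K. Kato, Astérisque 295 (2004) (12.5.2) [Kato2004Asterisque]; J.-P. Serre, Invent. 15 (1972)
Prop. 21 [Serre1972]; R. L. Miller, LMS JCM 14 (2011) Def. 1.1 [Miller2011LMS]; tree files `X4/KuriharaLowerHalf.lean`,
`Literature/…/PerrinRiou2003/RankZeroSupersingularUpperBound.lean`, `Supersingular/X6KuriharaOfferShape.lean`, `CyclicityLadder.lean`;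
iw-2 `ENGINE-K-P9.md` §N4TAM.
-/

set_option autoImplicit false

noncomputable section

open scoped Classical MatrixGroups ModularForm

open CongruenceSubgroup WeierstrassCurve Literature.NumberTheory.EllipticCurves
  Literature.NumberTheory.EllipticCurves.ModularForms
  Literature.NumberTheory.EllipticCurves.Rank1Residual
  Literature.NumberTheory.EllipticCurves.Rank1Residual.Typed
  Literature.NumberTheory.EllipticCurves.Rank1Residual.X11RankOneCertificates
  Summit.BirchSwinnertonDyer.BirchSwinnertonDyer.Rank1Residual.IntModel
  Summit.BirchSwinnertonDyer.BirchSwinnertonDyer.Rank1Residual.X11RankOne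
  Summit.BirchSwinnertonDyer.Rank1Residual.X11b
  Summit.BirchSwinnertonDyer.Rank1Residual.Additive
  Summit.BirchSwinnertonDyer.Rank1Residual.Supersingular.KuriharaTwist

namespace Summit.BirchSwinnertonDyer.Rank1Residual.Supersingular

/-! ### §1 The class form -/

/-- **N4 TAM-DEFECT, class form — `BSD(E,p)` on X6 ∧ `r_an = 0` ∧ `p ≥ 5` from ONE depth-`k` Kurihara number, `k ≤ ord_p ∏c_ℓ + 1`.**
Lower half: Kim 2026 Thm. 1.8 (6) (`hKimL`, PUBLISHED; `X4.bsdp_rankZero_of_kimLower_of_missingUpperBoundAt`); upper half: Perrin-Riou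
2003 Prop. 4.8 (`h48`, PUBLISHED; `missingUpperBoundAt_of_prop48_of_surj`); surj(p) automatic on X6 (`ClassX6.surj`).  Data binders:
`D` with `p ∤ c_D`, the period transfer `hper`, the cyclic level, `ψ`, `hδ`.  Per pair; NOT a class theorem; nothing booked.
[cite: Kim2022StructureSelmer, Thm. 1.9 (6) (PDF p. 8) and §1.5.1–1.5.3 (PDF pp. 7–8)] [cite: PerrinRiou2003, Prop. 4.8 (p. 162)]
[cite: Kato2004Asterisque, (12.5.2) in Thm. 12.5 (4) (p. 222)] [cite: Serre1972, §5.4 Prop. 21 i)] [cite: Miller2011LMS, Def. 1.1] -/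
theorem X6RankZero.bsdp_of_kimLower_of_prop48 (W : WeierstrassCurve ℚ) [W.IsElliptic] [W.IsGloballyMinimal]
    (p : ℕ) [Fact p.Prime]
    (hKimL : Kim2026.rankZero_le_padicValNat_sha_of_kuriharaNumber_ne_zero)
    (h48 : PerrinRiou2003.prop48_padicValRat_bsd_rank_zero_le)
    (hGZK : rank_eq_analyticRank_of_analyticRank_le_one) (hmod : hasEntireLFunction_rat)
    (hp5 : 5 ≤ p) (hX : ClassX6 W p) (hr : W.analyticRank = 0)
    {N : ℕ} [NeZero N] (D : ModularParametrizationData W N) (hc : ¬ (p : ℤ) ∣ D.maninConstant)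
    (hper : ∃ u : ℚ, ‖(u : ℚ_[p])‖ = 1 ∧ W.realPeriodRat = u * plusPeriod D.f)
    (k n : ℕ) [NeZero n] (hk : 1 ≤ k) (hkt : k ≤ padicValNat p W.tamagawaProduct + 1)
    (hn : Kato.IsKolyvaginProduct W p k n)
    (hcyc : ∀ (ℓ : ℕ) [Fact ℓ.Prime], ℓ ∣ n →
      Nat.card {P : ((WeierstrassCurve.integralModelInt W).map
          (Int.castRingHom (ZMod ℓ))).toAffine.Point // p • P = 0} ≤ p)
    (ψ : (ℓ : ℕ) → (ZMod ℓ)ˣ →* Multiplicative (ZMod (p ^ k)))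
    (hψ : ∀ ℓ ∈ n.primeFactors, Function.Surjective (ψ ℓ))
    (hδ : kuriharaNumber D.f (p ^ k) n ψ ≠ 0) : BSDp W p := by
  have hsurj : Surj W p := ClassX6.surj W p (by omega) hX
  have hL : W.entireLFunction 1 ≠ 0 := (W.analyticRank_eq_zero_iff_holds (hmod W)).1 hr
  exact X4.bsdp_rankZero_of_kimLower_of_missingUpperBoundAt W p hKimL hGZK hp5 hsurj hL D hc hper k n hk hkt hn hcyc ψ
    hψ hδ (PerrinRiou2003.missingUpperBoundAt_of_prop48_of_surj W p h48 hGZK hmod hp5 hX.1 hsurj hr)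

/-! ### §2 The literal-equation record shape (two-prime level `ℓ₁ℓ₂ ∈ 𝒩_k`) -/

/-- Surjectivity at every prime factor of `ℓ₁ℓ₂` for an ARBITRARY family `ψ` surjective at `ℓ₁` and `ℓ₂`. [folklore] -/
theorem surjective_family_of_mem_primeFactors_mul {M : ℕ} {ℓ₁ ℓ₂ : ℕ} (h₁ : ℓ₁.Prime) (h₂ : ℓ₂.Prime)
    (ψ : (ℓ : ℕ) → (ZMod ℓ)ˣ →* Multiplicative (ZMod M))
    (hψ₁ : Function.Surjective (ψ ℓ₁)) (hψ₂ : Function.Surjective (ψ ℓ₂)) :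
    ∀ ℓ ∈ (ℓ₁ * ℓ₂).primeFactors, Function.Surjective (ψ ℓ) := by
  intro ℓ hℓ
  rw [Nat.primeFactors_mul h₁.ne_zero h₂.ne_zero, h₁.primeFactors, h₂.primeFactors, Finset.mem_union,
    Finset.mem_singleton, Finset.mem_singleton] at hℓ
  rcases hℓ with rfl | rfl
  · exact hψ₁
  · exact hψ₂

/-- **N4 TAM-DEFECT RECORD SHAPE — `BSD(E,p)` on X6 ∧ `r_an = 0` ∧ `p ≥ 5` from the literal equation, a CYCLIC two-prime level
`ℓ₁ℓ₂ ∈ 𝒩_k` certified in the kernel, and ONE depth-`k` Kurihara number `δ̃_{ℓ₁ℓ₂}^{(k)} ≢ 0 (mod p^k)` with `k ≤ ord_p ∏c_ℓ + 1`.**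
Decidable inputs (per record): minimality (instance; x11c bounded Kraus), `p ∤ Δ`, `countPoints … p = n_p` with `p ∣ p + 1 − n_p`,
`gcd(Δ, c₄) = 1` (class X6 via `classX6_of_intModel`); `ℓᵢ ∤ Δ`, `ℓᵢ ≡ 1 (mod p^k)`, `countPoints … ℓᵢ = nᵢ`, `p^k ∣ nᵢ` (Kolyvagin primes
of depth `k`); the two CYCLICITY bounds `#Ẽ(𝔽_ℓᵢ)[p] ≤ p` in the literal-model form (`CyclicityLadder.card_torsion_le_of_ladder`).
REMAINING HYPOTHESES = EXACTLY `hKimL`, `h48` (PUBLISHED), `hGZK`, `hmod`; the data binders `r_an = 0`, `k ≤ ord_p ∏c_ℓ + 1` (Cremona),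
`D` with `p ∤ c_D`, the period transfer `hper`; a family `ψ` surjective at `ℓ₁, ℓ₂`; and `hδ : kuriharaNumber D.f (p^k) (ℓ₁ℓ₂) ψ ≠ 0`
(the depth-`k` certificate value — independent of the choice of `ψ`).  Per pair; NOT a class theorem; nothing booked.
[cite: Kim2022StructureSelmer, Thm. 1.9 (6) (PDF p. 8), §1.2.2 (PDF p. 5) and §1.5.1–1.5.3 (PDF pp. 7–8)] [cite: PerrinRiou2003, Prop. 4.8 (p. 162)]
[cite: SilvermanAEC2009, VII.1 Remark 1.1, VII.5 Prop. 5.1(a) and (b)] [cite: IrelandRosen1990, Prop. 5.1.2 and §8.1] [cite: Miller2011LMS, Def. 1.1] -/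
theorem X6RankZero.bsdp_of_kimLower_of_prop48_of_ainvs
    (hKimL : Kim2026.rankZero_le_padicValNat_sha_of_kuriharaNumber_ne_zero)
    (h48 : PerrinRiou2003.prop48_padicValRat_bsd_rank_zero_le)
    (hGZK : rank_eq_analyticRank_of_analyticRank_le_one) (hmod : hasEntireLFunction_rat)
    (a1 a2 a3 a4 a6 : ℤ) (hmin : (⟨a1, a2, a3, a4, a6⟩ : WeierstrassCurve ℚ).IsGloballyMinimal)
    (p : ℕ) [Fact p.Prime] (hp5 : 5 ≤ p)
    (hpΔ : ¬ (p : ℤ) ∣ discOf [a1, a2, a3, a4, a6]) {np : ℕ} (hcnt : countPoints [a1, a2, a3, a4, a6] p = np)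
    (hap : (p : ℤ) ∣ (p : ℤ) + 1 - np) (hgcd : Int.gcd (discOf [a1, a2, a3, a4, a6]) (c4Of [a1, a2, a3, a4, a6]) = 1)
    -- the cyclic level `ℓ₁ℓ₂ ∈ 𝒩_k`
    (k : ℕ) (hk : 1 ≤ k) (ℓ₁ ℓ₂ : ℕ) [Fact ℓ₁.Prime] [Fact ℓ₂.Prime] (hne : ℓ₁ ≠ ℓ₂)
    (hℓ₁p : ℓ₁ ≠ p) (hℓ₂p : ℓ₂ ≠ p) (hℓ₁2 : ℓ₁ ≠ 2) (hℓ₂2 : ℓ₂ ≠ 2)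
    (hℓ₁Δ : ¬ (ℓ₁ : ℤ) ∣ discOf [a1, a2, a3, a4, a6]) (hℓ₂Δ : ¬ (ℓ₂ : ℤ) ∣ discOf [a1, a2, a3, a4, a6])
    (h1₁ : ℓ₁ ≡ 1 [MOD p ^ k]) (h1₂ : ℓ₂ ≡ 1 [MOD p ^ k]) {n₁ n₂ : ℕ}
    (hc₁ : countPoints [a1, a2, a3, a4, a6] ℓ₁ = n₁) (hc₂ : countPoints [a1, a2, a3, a4, a6] ℓ₂ = n₂)
    (hd₁ : p ^ k ∣ n₁) (hd₂ : p ^ k ∣ n₂)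
    (hcyc₁ : Nat.card {P : (((⟨a1, a2, a3, a4, a6⟩ : WeierstrassCurve ℤ)).map
        (Int.castRingHom (ZMod ℓ₁))).toAffine.Point // p • P = 0} ≤ p)
    (hcyc₂ : Nat.card {P : (((⟨a1, a2, a3, a4, a6⟩ : WeierstrassCurve ℤ)).map
        (Int.castRingHom (ZMod ℓ₂))).toAffine.Point // p • P = 0} ≤ p)
    -- data binders
    (hr0 : (⟨a1, a2, a3, a4, a6⟩ : WeierstrassCurve ℚ).analyticRank = 0)
    (hkt : k ≤ padicValNat p (⟨a1, a2, a3, a4, a6⟩ : WeierstrassCurve ℚ).tamagawaProduct + 1)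
    {N : ℕ} [NeZero N] (D : ModularParametrizationData (⟨a1, a2, a3, a4, a6⟩ : WeierstrassCurve ℚ) N)
    (hc : ¬ (p : ℤ) ∣ D.maninConstant)
    (hper : ∃ u : ℚ, ‖(u : ℚ_[p])‖ = 1 ∧
      (⟨a1, a2, a3, a4, a6⟩ : WeierstrassCurve ℚ).realPeriodRat = u * plusPeriod D.f)
    (ψ : (ℓ : ℕ) → (ZMod ℓ)ˣ →* Multiplicative (ZMod (p ^ k)))
    (hψ₁ : Function.Surjective (ψ ℓ₁)) (hψ₂ : Function.Surjective (ψ ℓ₂))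
    (hδ : kuriharaNumber D.f (p ^ k) (ℓ₁ * ℓ₂) ψ ≠ 0) :
    BSDp (⟨a1, a2, a3, a4, a6⟩ : WeierstrassCurve ℚ) p := by
  have h0 : discOf [a1, a2, a3, a4, a6] ≠ 0 := fun h ↦ hpΔ (by rw [h]; exact dvd_zero _)
  haveI := isElliptic_of_discOf_ne_zero a1 a2 a3 a4 a6 h0
  haveI := hmin
  have hp2 : p ≠ 2 := by omega
  have hI : integralModelInt (⟨a1, a2, a3, a4, a6⟩ : WeierstrassCurve ℚ) = ⟨a1, a2, a3, a4, a6⟩ :=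
    integralModelInt_eq_of_map_eq _ (map_mk_int a1 a2 a3 a4 a6)
  have hN₁ := natCard_point_eq_of_countPoints a1 a2 a3 a4 a6 ℓ₁ hℓ₁2 hℓ₁Δ hc₁
  have hN₂ := natCard_point_eq_of_countPoints a1 a2 a3 a4 a6 ℓ₂ hℓ₂2 hℓ₂Δ hc₂
  -- class X6 at `p`
  have hX : ClassX6 (⟨a1, a2, a3, a4, a6⟩ : WeierstrassCurve ℚ) p :=
    classX6_of_intModel p hp5 hI (by rw [intCurve_Δ]; exact hpΔ)
      (natCard_point_eq_of_countPoints a1 a2 a3 a4 a6 p hp2 hpΔ hcnt) hap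
      (by rw [intCurve_Δ, intCurve_c₄]; exact hgcd)
  -- the Kolyvagin level of depth `k`
  have hK₁ : Kato.IsKolyvaginPrime (⟨a1, a2, a3, a4, a6⟩ : WeierstrassCurve ℚ) p k ℓ₁ :=
    Additive.isKolyvaginPrime_of_intModel_of_card hI p k ℓ₁ hℓ₁p (by rw [intCurve_Δ]; exact hℓ₁Δ) h1₁ hN₁ hd₁
  have hK₂ : Kato.IsKolyvaginPrime (⟨a1, a2, a3, a4, a6⟩ : WeierstrassCurve ℚ) p k ℓ₂ :=
    Additive.isKolyvaginPrime_of_intModel_of_card hI p k ℓ₂ hℓ₂p (by rw [intCurve_Δ]; exact hℓ₂Δ) h1₂ hN₂ hd₂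
  have hn : Kato.IsKolyvaginProduct (⟨a1, a2, a3, a4, a6⟩ : WeierstrassCurve ℚ) p k (ℓ₁ * ℓ₂) :=
    Additive.isKolyvaginProduct_mul hK₁ hK₂ hne
  haveI : NeZero (ℓ₁ * ℓ₂) := ⟨Nat.mul_ne_zero (Fact.out : ℓ₁.Prime).ne_zero (Fact.out : ℓ₂.Prime).ne_zero⟩
  -- cyclicity at both level primes, in the consumer's `integralModelInt` form
  have hcyc : ∀ (ℓ : ℕ) [Fact ℓ.Prime], ℓ ∣ ℓ₁ * ℓ₂ →
      Nat.card {P : ((WeierstrassCurve.integralModelInt (⟨a1, a2, a3, a4, a6⟩ : WeierstrassCurve ℚ)).map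
          (Int.castRingHom (ZMod ℓ))).toAffine.Point // p • P = 0} ≤ p := by
    rw [hI]
    exact forall_card_torsion_le_of_level ⟨a1, a2, a3, a4, a6⟩ p (ℓ₁ * ℓ₂) ℓ₁ ℓ₂ rfl hcyc₁ hcyc₂
  exact X6RankZero.bsdp_of_kimLower_of_prop48 _ p hKimL h48 hGZK hmod hp5 hX hr0 D hc hper k (ℓ₁ * ℓ₂) hk hkt hn
    hcyc ψ (surjective_family_of_mem_primeFactors_mul Fact.out Fact.out ψ hψ₁ hψ₂) hδ

end Summit.BirchSwinnertonDyer.Rank1Residual.Supersingular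

end
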